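import Summits.Parity.GeneralizedHardyLittlewood.Theorems.LiouvilleShiftedTablesTypeI2DilatedPeel1

/-!
# The peel, part 2/6: matching Theorem 5.1; bounds for the peeled coefficients and blocks

Route `LiouvilleShiftedTables` (Parity / GeneralizedHardyLittlewood), crux `TypeI2Dilated` (stmt-Parity-14272),
line `peel-to-drappeau`, registered stub `stub_peel : PeelStep` (`PeelStep := DrappeauTypeII → DilatedTypeIICore`,
vocabulary in `…Theorems.LiouvilleShiftedTablesDefs`).  THE PEEL moves the two rough moduli
(`r` and the dilation `q`, both `≤ x^ρ`) and their classes onto the coefficients, so that Drappeau's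
hypothesis-free Theorem 5.1 (S. Drappeau, Proc. LMS 114 (2017), arXiv:1504.05549, §5 — the Literature named
fact `Drappeau2017_theorem51`, taken as the hypothesis `DrappeauTypeII`) applies on the smooth modulus `s` alone:
CRT class `e mod lcm(q, r)` → `g ∣ mh` × a unit class expanded in characters `ξ mod L'` (absorbed into `α`, `β`),
the `(qr)^∞`-part `h` of the `β`-variable split off (`h ≤ x^{6ρ₀}`: Theorem 5.1 at `x' = MN/h` with
`a₁ = c·qr`, `a₂ = h·qr`; `h > x^{6ρ₀}`: the trivial bound (5.2) and `∑_{h ∣ (qr)^∞} h^{-1/2} ≤ τ(qr)²`),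
`ρ₀ = min(δ_{5.1}(η/2), η)/100`.  Everything here is PROVED; the only non-Mathlib inputs are the Literature
lemmas `Literature.NumberTheory.Sieve.DrappeauDispersionLemmas` (all proved) and the divisor bound
(`DivisorBound`, `DivisorPowerSums`).

The chain (each file imports the previous one):
* part 1: the peeled objects and THE PEEL identity (`…TypeI2DilatedPeel1`)
* part 2: matching Theorem 5.1; bounds for the peeled coefficients and blocks (`…TypeI2DilatedPeel2`)
* part 3: CRT, from blocks to the pair, and the main blocks via Theorem 5.1 (`…TypeI2DilatedPeel3`)
* part 4: the per-pair bound (`…TypeI2DilatedPeel4`)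
* part 5: the crux sum at one height `x` (`…TypeI2DilatedPeel5`)
* part 6: constants, thresholds and `stub_peel` (`…TypeI2DilatedPeel6`)

[this line; cite: Drappeau2017, Thm 5.1, §5 (5.1)–(5.2)]
-/

noncomputable section

namespace Summit.Parity.GeneralizedHardyLittlewood.Cruxes.TypeI2Dilated.PeelToDrappeau

open Finset Real
open scoped ArithmeticFunction.sigma Classical
open Literature.NumberTheory.Sieve Literature.NumberTheory.Sieve.Drappeau2017

/-! ### Matching Drappeau's Theorem 5.1 (moduli `a₁ = cP`, `a₂ = hP`, `P = qr`) -/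

/-- **The rational residue**: for `(s, c) = (s, P) = 1`, `(m h n) c̄ = (m n) · (cP)⁻¹ · (hP)` in
`ZMod s`. [this line] -/
theorem residue_eq {s : ℕ} {c : ℤ} {P : ℕ} (hc : IsCoprime (s : ℤ) c) (hP : s.Coprime P)
    (m h n : ℕ) :
    ((m * (h * n) : ℕ) : ZMod s) * ((c : ZMod s))⁻¹ =
      ((m * n : ℕ) : ZMod s) * (((c * (P : ℤ) : ℤ) : ZMod s))⁻¹ * (((h * P : ℕ) : ℤ) : ZMod s) := by
  have uc : IsUnit ((c : ZMod s)) := (ZMod.coe_int_isUnit_iff_isCoprime c s).2 hc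
  have uP : IsUnit ((P : ZMod s)) := (ZMod.isUnit_iff_coprime P s).2 hP.symm
  push_cast
  rw [zmod_mul_inv_of_isUnit uc uP]
  have hPP : (P : ZMod s)⁻¹ * (P : ZMod s) = 1 := ZMod.inv_mul_of_unit _ uP
  calc (m : ZMod s) * ((h : ZMod s) * (n : ZMod s)) * (c : ZMod s)⁻¹
      = (m : ZMod s) * (n : ZMod s) * (c : ZMod s)⁻¹ * (h : ZMod s) *
          ((P : ZMod s)⁻¹ * (P : ZMod s)) := by rw [hPP, mul_one]; ring
    _ = _ := by ring

/-- **The `s`-range is Theorem 5.1's**: `{Slo < s ≤ 2Slo, (s, qr) = (s, c) = 1} =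
{s ∼ Slo : (s, a₁a₂) = 1}` for `a₁ = c·qr`, `a₂ = h·qr`, `h ∣ (qr)^∞`. [this line] -/
theorem sRange_eq_filter {c : ℤ} {q r : ℕ} {Slo : ℝ} (hSlo : 0 ≤ Slo) {h : ℕ} (hh : h ≠ 0)
    (hhS : h.primeFactors ⊆ (q * r).primeFactors) {a₁ a₂ : ℤ} (ha₁ : a₁ = c * ((q * r : ℕ) : ℤ))
    (ha₂ : a₂ = ((h * (q * r) : ℕ) : ℤ)) :
    sRange c q r Slo (2 * Slo) =
      (BFI.dyadic Slo).filter (fun s : ℕ => IsCoprime (s : ℤ) (a₁ * a₂)) := by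
  ext s
  simp only [sRange, BFI.dyadic, Finset.mem_filter, Finset.mem_Icc, Finset.mem_range, ha₁, ha₂,
    IsCoprime.mul_right_iff, Nat.cast_mul, Nat.isCoprime_iff_coprime, Nat.lt_add_one_iff,
    Nat.coprime_mul_iff_right]
  constructor
  · rintro ⟨⟨-, h2⟩, h3, h4, h5⟩
    exact ⟨⟨h2, h3⟩, ⟨h5, h4⟩, coprime_of_primeFactors_subset hh hhS (Nat.Coprime.mul_right h4.1 h4.2),
      h4⟩
  · rintro ⟨⟨h2, h3⟩, ⟨h5, h4⟩, -, -⟩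
    have hs1 : 1 ≤ s := by
      have : (0 : ℝ) < s := hSlo.trans_lt h3
      exact_mod_cast this
    exact ⟨⟨hs1, h2⟩, h3, h4, h5⟩

/-- **The `n`-filter is Theorem 5.1's**: `(n, P) = 1 ⇔ (n, a₂) = 1` for `a₂ = hP`, `h ∣ P^∞`.
[this line] -/
theorem filter_coprime_eq {P h : ℕ} (hh : h ≠ 0) (hhS : h.primeFactors ⊆ P.primeFactors)
    (D : Finset ℕ) {a₂ : ℤ} (ha₂ : a₂ = ((h * P : ℕ) : ℤ)) :
    D.filter (fun n => n.Coprime P) = D.filter (fun n : ℕ => IsCoprime (n : ℤ) a₂) := by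
  refine Finset.filter_congr fun n _ => ?_
  rw [ha₂, Nat.isCoprime_iff_coprime, Nat.coprime_mul_iff_right]
  exact ⟨fun h' => ⟨coprime_of_primeFactors_subset hh hhS h', h'⟩, fun h' => h'.2⟩

/-- The peeled `β`-coefficient renormalised by `τ(h)^K` (so that it is again `τ^K`-bounded).
[this line] -/
def bCoefN (β : ℕ → ℂ) (h L' : ℕ) (ξ : DirichletCharacter ℂ L') (K : ℝ) (n : ℕ) : ℂ :=
  bCoef β h L' ξ n / (((σ 0 h : ℝ) ^ K : ℝ) : ℂ)

/-- `τ(h)^K > 0` for `h ≥ 1`. [folklore] -/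
theorem sigma_rpow_pos {h : ℕ} (hh : h ≠ 0) (K : ℝ) : (0 : ℝ) < (σ 0 h : ℝ) ^ K := by
  have : (1 : ℝ) ≤ (σ 0 h : ℝ) := by exact_mod_cast one_le_sigma_zero hh
  exact Real.rpow_pos_of_pos (by linarith) K

/-- **THE PEEL meets Theorem 5.1**: the `s`-sum of the peeled block is `τ(h)^K` times an instance
of the triple sum of Drappeau's Theorem 5.1 with `S = Slo`, scales `(M, N/h)`, moduli
`a₁ = c·qr`, `a₂ = h·qr`, coefficients `α^{(h,ξ)}`, `β^{(h,ξ)}/τ(h)^K`. [this line] -/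
theorem sum_Eblock_eq {c : ℤ} (Rd : ℝ) {q r : ℕ} {Slo : ℝ} (hSlo : 0 ≤ Slo)
    (M N : ℝ) (α β : ℕ → ℂ) {g h L' : ℕ} (hh : h ≠ 0)
    (hhS : h.primeFactors ⊆ (q * r).primeFactors) (ξ : DirichletCharacter ℂ L') (K : ℝ) {a₁ a₂ : ℤ}
    (ha₁ : a₁ = c * ((q * r : ℕ) : ℤ)) (ha₂ : a₂ = ((h * (q * r) : ℕ) : ℤ)) :
    ∑ s ∈ sRange c q r Slo (2 * Slo), Eblock c Rd M N α β (q * r) g h L' ξ s =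
      (((σ 0 h : ℝ) ^ K : ℝ) : ℂ) *
        ∑ s ∈ (BFI.dyadic Slo).filter (fun s : ℕ => IsCoprime (s : ℤ) (a₁ * a₂)),
          ∑ m ∈ BFI.dyadic M, ∑ n ∈ (BFI.dyadic (N / h)).filter (fun n : ℕ => IsCoprime (n : ℤ) a₂),
            aCoef α g h L' ξ m * bCoefN β h L' ξ K n *
              uR Rd s (((m * n : ℕ) : ZMod s) * ((a₁ : ZMod s))⁻¹ * ((a₂ : ZMod s))) := by
  have hD : ((((σ 0 h : ℝ) ^ K : ℝ) : ℂ)) ≠ 0 := by exact_mod_cast (sigma_rpow_pos hh K).ne'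
  rw [Finset.mul_sum, ← sRange_eq_filter hSlo hh hhS ha₁ ha₂]
  refine Finset.sum_congr rfl fun s hs => ?_
  have hs' := hs
  simp only [sRange, Finset.mem_filter, Finset.mem_Icc] at hs'
  obtain ⟨-, -, hsP, hsc⟩ := hs'
  unfold Eblock
  rw [Finset.mul_sum]
  refine Finset.sum_congr rfl fun m _ => ?_
  rw [Finset.mul_sum, ← filter_coprime_eq hh hhS _ ha₂]
  refine Finset.sum_congr rfl fun n _ => ?_
  unfold bCoefN Fker
  rw [residue_eq hsc hsP m h n, ← ha₂]
  have e1 : ((c * ((q * r : ℕ) : ℤ) : ℤ) : ZMod s) = ((a₁ : ZMod s)) := by rw [ha₁]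
  rw [e1]
  field_simp

/-! ### Bounds for the peeled coefficients and blocks -/

/-- `|α^{(h,ξ)}(m)| ≤ |α(m)|`. [this line] -/
theorem norm_aCoef_le (α : ℕ → ℂ) (g h L' : ℕ) (ξ : DirichletCharacter ℂ L') (m : ℕ) :
    ‖aCoef α g h L' ξ m‖ ≤ ‖α m‖ := by
  unfold aCoef
  rw [norm_mul]
  refine mul_le_of_le_one_left (norm_nonneg _) ?_
  split_ifs
  · exact ξ.norm_le_one _
  · simp

/-- `|β^{(h,ξ)}(n)| ≤ |β(hn)|`. [this line] -/
theorem norm_bCoef_le (β : ℕ → ℂ) (h L' : ℕ) (ξ : DirichletCharacter ℂ L') (n : ℕ) :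
    ‖bCoef β h L' ξ n‖ ≤ ‖β (h * n)‖ := by
  unfold bCoef
  rw [norm_mul]
  exact mul_le_of_le_one_left (norm_nonneg _) (ξ.norm_le_one _)

/-- `|β^{(h,ξ)}(n)|/τ(h)^K ≤ τ(n)^K` when `|β| ≤ τ^K` (`τ(hn) ≤ τ(h)τ(n)`). [this line] -/
theorem norm_bCoefN_le {β : ℕ → ℂ} {K : ℝ} (hK : 0 ≤ K) (hβ : ∀ n, ‖β n‖ ≤ (σ 0 n : ℝ) ^ K)
    {h : ℕ} (hh : h ≠ 0) (L' : ℕ) (ξ : DirichletCharacter ℂ L') (n : ℕ) :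
    ‖bCoefN β h L' ξ K n‖ ≤ (σ 0 n : ℝ) ^ K := by
  have hD := sigma_rpow_pos hh K
  unfold bCoefN
  rw [norm_div, Complex.norm_real, Real.norm_of_nonneg hD.le, div_le_iff₀ hD]
  calc ‖bCoef β h L' ξ n‖ ≤ ‖β (h * n)‖ := norm_bCoef_le β h L' ξ n
    _ ≤ (σ 0 (h * n) : ℝ) ^ K := hβ _
    _ ≤ ((σ 0 h : ℝ) * (σ 0 n : ℝ)) ^ K :=
        Real.rpow_le_rpow (Nat.cast_nonneg _) (by exact_mod_cast sigma_zero_mul_le h n) hK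
    _ = (σ 0 n : ℝ) ^ K * (σ 0 h : ℝ) ^ K := by
        rw [Real.mul_rpow (Nat.cast_nonneg _) (Nat.cast_nonneg _), mul_comm]

/-- **Tail blocks** (`h > H`), trivially: `‖∑_s E(h, ξ, s)‖ ≤ ∑_{m, n} |α(m)| |β(hn)| ∑_s |F(s, mhn)|`.
[this line] -/
theorem tail_block_bound (c : ℤ) (Rd : ℝ) (q r : ℕ) (Slo M N : ℝ) (α β : ℕ → ℂ) (P g h L' : ℕ)
    (ξ : DirichletCharacter ℂ L') :
    ‖∑ s ∈ sRange c q r Slo (2 * Slo), Eblock c Rd M N α β P g h L' ξ s‖ ≤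
      ∑ m ∈ BFI.dyadic M, ∑ n ∈ (BFI.dyadic (N / h)).filter (fun n => n.Coprime P),
        ‖α m‖ * ‖β (h * n)‖ * ∑ s ∈ sRange c q r Slo (2 * Slo), ‖Fker c Rd s (m * (h * n))‖ := by
  unfold Eblock
  rw [Finset.sum_comm]
  refine (norm_sum_le _ _).trans (Finset.sum_le_sum fun m _ => ?_)
  rw [Finset.sum_comm]
  refine (norm_sum_le _ _).trans (Finset.sum_le_sum fun n _ => ?_)
  rw [Finset.mul_sum]
  refine (norm_sum_le _ _).trans (Finset.sum_le_sum fun s _ => ?_)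
  rw [norm_mul, norm_mul]
  refine mul_le_mul_of_nonneg_right ?_ (norm_nonneg _)
  exact mul_le_mul (norm_aCoef_le _ _ _ _ _ _) (norm_bCoef_le _ _ _ _ _) (norm_nonneg _)
    (norm_nonneg _)

/-- **The `s`-sum of `|F(s, k)|`, trivially**: `∑_{s} |𝔲_{Rd}(k c̄; s)| ≤ τ(|k − c|) + Rd ∑_{s ≤ 2Slo}
τ(s)²/s` for `k ≠ c` (`k c̄ ≡ 1 (s)` forces `s ∣ k − c`; `1/φ(s) ≤ τ(s)/s`). [this line] -/
theorem sum_norm_Fker_le {c : ℤ} {Rd : ℝ} (hRd : 0 ≤ Rd) (q r : ℕ) (Slo : ℝ) {k : ℕ}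
    (hk : (k : ℤ) ≠ c) :
    ∑ s ∈ sRange c q r Slo (2 * Slo), ‖Fker c Rd s k‖ ≤
      (σ 0 ((k : ℤ) - c).natAbs : ℝ) + Rd * ∑ s ∈ Icc 1 ⌊2 * Slo⌋₊, (σ 0 s : ℝ) ^ 2 / s := by
  have hsub : sRange c q r Slo (2 * Slo) ⊆ Icc 1 ⌊2 * Slo⌋₊ := Finset.filter_subset _ _
  have step1 : ∑ s ∈ sRange c q r Slo (2 * Slo), ‖Fker c Rd s k‖ ≤
      ∑ s ∈ sRange c q r Slo (2 * Slo),
        ((if ((k : ℕ) : ZMod s) * ((c : ZMod s))⁻¹ = 1 then (1 : ℝ) else 0) +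
          Rd * ((σ 0 s : ℝ) ^ 2 / s)) := by
    refine Finset.sum_le_sum fun s hs => ?_
    have hs1 : 0 < s := (Finset.mem_Icc.1 (hsub hs)).1
    refine (norm_uR_le hs1 hRd _).trans (add_le_add le_rfl ?_)
    rw [mul_div_assoc]
    refine mul_le_mul_of_nonneg_left ?_ hRd
    rw [div_eq_mul_inv, sq, mul_div_assoc]
    exact mul_le_mul_of_nonneg_left (inv_totient_le_sigma_zero_div s) (Nat.cast_nonneg _)
  refine step1.trans ?_
  rw [Finset.sum_add_distrib, ← Finset.mul_sum]
  refine add_le_add ?_ ?_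
  · -- the `s ∣ k - c` count
    rw [← Finset.sum_filter, Finset.sum_const, nsmul_eq_mul, mul_one, ArithmeticFunction.sigma_zero_apply]
    norm_cast
    refine Finset.card_le_card_of_injOn id (fun s hs => ?_) (Set.injOn_id _)
    rw [Finset.coe_filter] at hs
    obtain ⟨hs, hks⟩ := hs
    have hs1 : 0 < s := (Finset.mem_Icc.1 (hsub hs)).1
    have hsc : IsCoprime (s : ℤ) c := by
      simp only [sRange, Finset.mem_filter] at hs
      exact hs.2.2.2
    have uc : IsUnit ((c : ZMod s)) := (ZMod.coe_int_isUnit_iff_isCoprime c s).2 hsc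
    have hkc : ((k : ℤ) : ZMod s) = ((c : ℤ) : ZMod s) := by
      have := congrArg (· * (c : ZMod s)) hks
      simpa [mul_assoc, ZMod.inv_mul_of_unit _ uc] using this
    rw [ZMod.intCast_eq_intCast_iff_dvd_sub, Int.natCast_dvd] at hkc
    simp only [id, Finset.mem_coe, Nat.mem_divisors]
    refine ⟨?_, ?_⟩
    · rwa [← Int.natAbs_neg, neg_sub]
    · rw [ne_eq, Int.natAbs_eq_zero, sub_eq_zero]
      exact hk
  · refine mul_le_mul_of_nonneg_left ?_ hRd
    exact Finset.sum_le_sum_of_subset_of_nonneg hsub fun s _ _ => by positivity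

/-- Landing anchor of the split peel chain (file 2 of 6): a registered, mathematically vacuous sub-goal
(`ledger workitem stub-add … --name peelChain2_anchor --signature 'True'`) so that this intermediate file passes
the gate's supports check; the registered stub `stub_peel` is proved in file 6. [this line] -/
theorem peelChain2_anchor : True := trivial

end Summit.Parity.GeneralizedHardyLittlewood.Cruxes.TypeI2Dilated.PeelToDrappeau

end
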